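import Literature.NumberTheory.Transcendental.RoySmallValueOrbitLiouville
import Literature.NumberTheory.Transcendental.RoySmallValueOrbitSelection
import Mathlib.Analysis.SpecialFunctions.Log.Basic
import HarnessLib

/-!
# Roy's small value estimate for `𝔾ₐ × 𝔾ₘ` — §7 Step 2: the selected orbit lies in `𝒵(𝒞_D ∩ ℤ[X])`

Topic `Literature/NumberTheory/Transcendental`. Part of the formalisation of the proof of Roy 2013,
Theorem 1.1 (named fact `roy2013_thm_1_1`, `RoySmallValueEstimates.lean`), seat B. Source: D. Roy,
*A small value estimate for `𝔾ₐ × 𝔾ₘ`*, Mathematika 59 (2013) 333–363 = arXiv:1301.0663,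
Proposition 2.4 and the proof of Proposition 6.4 (pp. 7, 17), §7 Step 2 (p. 18):

> By Proposition 2.4, this means that `Z` is contained in `𝒵(𝒞)`, in particular in
> `𝒵(𝒟ⁱP ; 0 ≤ i < 2T)`. [...] (Step 2) there exists a 0-dimensional subvariety `Z = Z_D` of
> `ℙ²_ℚ` contained in `𝒵(𝒟ⁱP̃_D ; 0 ≤ i < 2T)` such that `h_{𝒞_D}(Z) ≤ −(D^δ/25)(…)`.

The orbit selection of this development (`LevelPkg.exists_orbit_step2`, `RoySmallValueStep2Orbit`)
produces an orbit `O` with a PRODUCT bound `∏_{j∈O} (|R_j(α_j)|/‖α_j‖^D · E_j) ≤ M` for all families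
of elements of `𝒞`, `E_j = e^{Y_w + D h_K(rep j)/[K:ℚ]}`, `M = ε^{w(O)/B} ≤ 1`. This file derives
from such a bound (for constant families) and Liouville's inequality on the orbit
(`ZeroConfigK.orbit_liouville_log'`) that **every integer form `R ∈ ℤ[X]_D` whose complexification
lies in `𝒞` vanishes at all points of `O`** as soon as `D h(O) + log M < ∑_{j∈O} log E_j`
(`ZeroConfigK.aeval_eq_zero_of_orbit_prod_bound`) — for the `E_j, M` above this condition reads
`(w(O)/B) log ε < Y_w #O`, automatic when `ε ≤ 1 < e^{Y_w}` (`orbit_condition_of_weights`). A value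
`R(α_j) = 0` at ONE point propagates to the orbit by conjugation (`aeval_rep_ne_zero_of_mem_orb`),
which is why the product bound (insensitive to zero values) suffices. Everything is proved; no
definitions, no named facts.

## References

* [Roy2013] D. Roy, *A small value estimate for 𝔾ₐ × 𝔾ₘ*, Mathematika 59 (2013), 333–363
  (arXiv:1301.0663), Proposition 2.4; §6, proof of Proposition 6.4; §7, Step 2.
-/

noncomputable section

open MvPolynomial Finset Height

namespace Literature.NumberTheory.Transcendental

namespace Roy2013

namespace ZeroConfigK

variable {K : IntermediateField ℚ ℂ} {ι : Type*} [Fintype ι] [DecidableEq ι] (Z : ZeroConfigK K ι)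
  [Normal ℚ K] [NumberField K]

/-- **Integer forms obeying the orbit product bound vanish on the orbit.** With `ok` the
admissibility predicate (membership in `𝒞`), positive weights `E_j`, and a bound
`∏_{j∈O} (|R(α_j)|/‖α_j‖^D · E_j) ≤ M` for every admissible `R`: if
`D·(∑_{j∈O} h_K(rep j))/[K:ℚ] + log M < ∑_{j∈O} log E_j` then every `R ∈ ℤ[X]_D` with admissible
complexification vanishes at all points of `O = orb i₀`.
[cite: Roy2013, Proposition 2.4; §6, proof of Proposition 6.4 ("`Z ⊆ 𝒵(𝒞)`")] -/
theorem aeval_eq_zero_of_orbit_prod_bound (i₀ : ι) (ok : CX → Prop) {D : ℕ} {E : ι → ℝ}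
    (hE : ∀ j, 0 < E j) {M : ℝ}
    (hO : ∀ R : CX, ok R →
      ∏ j ∈ Z.orb i₀, (‖aeval (Z.α j) R‖ / ‖Z.α j‖ ^ D * E j) ≤ M)
    (hX : (D : ℝ) * ((∑ j ∈ Z.orb i₀, logHeight (Z.rep j)) / Module.finrank ℚ K) + Real.log M <
      ∑ j ∈ Z.orb i₀, Real.log (E j))
    {R : MvPolynomial (Fin 3) ℤ} (hR : R.IsHomogeneous D) (hok : ok (map (Int.castRingHom ℂ) R)) :
    ∀ j ∈ Z.orb i₀, aeval (Z.α j) (map (Int.castRingHom ℂ) R) = 0 := by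
  -- values of the complexification are values of `R`
  have hval : ∀ j, aeval (Z.α j) (map (Int.castRingHom ℂ) R) = aeval (Z.α j) R := fun j => by
    rw [← algebraMap_int_eq, aeval_map_algebraMap]
  by_contra hcon
  push Not at hcon
  obtain ⟨j₁, hj₁, hne₁⟩ := hcon
  -- then `R(rep i₀) ≠ 0`, hence `R(α_j) ≠ 0` on the whole orbit
  have hrep : ∀ j, aeval (Z.rep j) R ≠ 0 ↔ aeval (Z.α j) (map (Int.castRingHom ℂ) R) ≠ 0 := by
    intro j
    rw [hval, ← Z.coe_aeval_rep_int j R]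
    exact ⟨fun h h0 => h (by exact_mod_cast h0), fun h h0 => h (by rw [h0]; rfl)⟩
  have hi₀ : aeval (Z.rep i₀) R ≠ 0 := by
    -- `i₀` lies in the orbit of `j₁`, and non-vanishing propagates along orbits
    have hmem : i₀ ∈ Z.orb j₁ := by rw [Z.orb_eq_of_mem hj₁]; exact Z.self_mem_orb i₀
    exact Z.aeval_rep_ne_zero_of_mem_orb hmem ((hrep j₁).mpr hne₁)
  have hall : ∀ j ∈ Z.orb i₀, aeval (Z.α j) (map (Int.castRingHom ℂ) R) ≠ 0 := fun j hj =>
    (hrep j).mp (Z.aeval_rep_ne_zero_of_mem_orb hj hi₀)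
  -- Liouville on the orbit
  have hL := Z.orbit_liouville_log' i₀ hR hi₀
  -- logarithm of the product bound for the constant family `R`
  have hB := hO (map (Int.castRingHom ℂ) R) hok
  have hpos : ∀ j ∈ Z.orb i₀, 0 < ‖aeval (Z.α j) (map (Int.castRingHom ℂ) R)‖ / ‖Z.α j‖ ^ D :=
    fun j hj => div_pos (norm_pos_iff.mpr (hall j hj)) (pow_pos (norm_pos_iff.mpr (Z.α_ne_zero j)) _)
  have hprodpos : 0 < ∏ j ∈ Z.orb i₀, (‖aeval (Z.α j) (map (Int.castRingHom ℂ) R)‖ / ‖Z.α j‖ ^ D * E j) :=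
    prod_pos fun j hj => mul_pos (hpos j hj) (hE j)
  have hlog := Real.log_le_log hprodpos hB
  rw [Real.log_prod (s := Z.orb i₀) (fun j hj => (mul_pos (hpos j hj) (hE j)).ne')] at hlog
  have hsplit : ∑ j ∈ Z.orb i₀, Real.log (‖aeval (Z.α j) (map (Int.castRingHom ℂ) R)‖ / ‖Z.α j‖ ^ D * E j) =
      ∑ j ∈ Z.orb i₀, Real.log (‖aeval (Z.α j) R‖ / ‖Z.α j‖ ^ D) +
        ∑ j ∈ Z.orb i₀, Real.log (E j) := by
    rw [← sum_add_distrib]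
    refine Finset.sum_congr rfl fun j hj => ?_
    rw [Real.log_mul (hpos j hj).ne' (hE j).ne', hval]
  rw [hsplit] at hlog
  linarith

end ZeroConfigK

/-- **The Step-2 weights satisfy the vanishing condition**: with `E_j = exp(Y_w + D h_j/n)` and
`M = ε^{w/B}`, `w = Y_w #O + D (∑_{j∈O} h_j)/n`: if `log ε ≤ 0`, `0 ≤ w/B` and `0 < Y_w #O` then
`D (∑ h_j)/n + log M < ∑ log E_j`. [cite: Roy2013, §7, Step 2 (the choice of the constants)] -/
theorem orbit_condition_of_weights {ι : Type*} (O : Finset ι) (h : ι → ℝ) {D Yw n ε B : ℝ}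
    (hε0 : 0 < ε) (hε : Real.log ε ≤ 0) (hO : 0 < Yw * O.card)
    (hwB : 0 ≤ (Yw * O.card + D * (∑ j ∈ O, h j) / n) / B) :
    D * ((∑ j ∈ O, h j) / n) + Real.log (ε ^ ((Yw * O.card + D * (∑ j ∈ O, h j) / n) / B)) <
      ∑ j ∈ O, Real.log (Real.exp (Yw + D * h j / n)) := by
  simp_rw [Real.log_exp]
  rw [Real.log_rpow hε0]
  have e1 : ∑ j ∈ O, (Yw + D * h j / n) = Yw * O.card + D * (∑ j ∈ O, h j) / n := by
    rw [sum_add_distrib, sum_const, nsmul_eq_mul, mul_comm (O.card : ℝ) Yw, mul_sum, sum_div]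
  rw [e1, ← mul_div_assoc]
  have h1 : (Yw * O.card + D * (∑ j ∈ O, h j) / n) / B * Real.log ε ≤ 0 :=
    mul_nonpos_of_nonneg_of_nonpos hwB hε
  linarith

end Roy2013

end Literature.NumberTheory.Transcendental
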